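import Summits.BirchSwinnertonDyer.BirchSwinnertonDyer.Theorems.ManinLocalTwoThreePinningKernelStaged
import Summits.BirchSwinnertonDyer.BirchSwinnertonDyer.Theorems.ManinLocalTwoThreePinningKernelFrickeStaged
import Summits.BirchSwinnertonDyer.BirchSwinnertonDyer.Theorems.ManinLocalTwoThreePinningTwoEightyEightTablesC
import Literature.NumberTheory.EllipticCurves.ModularFormsGamma0WeightTwoDimension
import HarnessLib

/-!
# LEVEL 288 (genus 33) PINNED BY THE FRICKE-STAGED PINNING KERNEL: THE NEWFORM OF EVERY `X₀(288)`-DATUM, FACT-FREE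

Cell `bsd-f2-manin`, route `ManinLocalTwoThree`, cruxes C2 `ManinOddAtFour` (stmt-BirchSwinnertonDyer-22967, `32 ∣ 288`) and C3 `ManinPrimeToThreeAtNine` (stmt-22968, `9 ∣ 288`), an g58
(LENS analytic/periods); `--supports stmt-BirchSwinnertonDyer-22967` (helper, the route's pinning series).  INSTANCE of
`…PinningKernel{Sieve,,Staged,Fricke,Cusp,FrickeStaged}`: part I's `exists_smul_eq_sum_of_frickeStaged` run in `S₂(Γ₀(288))` (`dim = g = 33`,
the tree's `finrank_cuspForm_two_eq_genusX0_holds`) on the `σ`-closed cuspidal `η`-basis of part 1, with the datum's newform `D.f` itself.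
WHY A NEW KERNEL PART: `a₂(W) = a₃(W) = 0`-type vanishing at the primes whose square divides `288` hides a large block of the basis from every
table column below the depth, so the column-relation sieve of parts B/D alone leaves thousands of assignments alive at this level (an g57
`README-g57 §102.7`); the Fricke relation `D.f ∣ w_288 = ε·D.f` (tree `fricke_coords`), turned into INTEGER RELATIONS among the `aₙ(W)` through the
integer duals (part I `exists_sign_frickeCombo_rel`), is fed INTO the sieve, once per sign.
THE RESULT.  Tables certified to depth 128 (sparse `η` certificates), integer duals `d = 288`, the two staged box sieves over `2, 3, 5, 7, 11, 13` keep at most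
9 assignments alive at any stage and leave exactly 2 (`ε = 1`: `288a`, `288b`) + 3 (`ε = −1`: `288c`, `288d`, `288e`) prime assignments, one per rational
newform class of level 288 (Cremona), each with an integer coordinate certificate (NO old-class ghosts: `p`-depleted old systems are not Fricke
eigen-combinations).  **`pinning_cusp (D)`**: for every `X₀(288)`-datum `D` of an elliptic `W/ℚ` there are the basis cusp forms `S` (values = the
`η`-quotients of `Ls`), their `M₂`-images `C`, and a certificate `(σ, d′, y) ∈ certP ++ certM` with `truth W ps = σ`, `d′ • D.f = Σ_j y_j • S j` in
`S₂(Γ₀(288))` and `d′ • f = Σ_j y_j • C j` in `M₂(Γ₀(288))`; `pinning (D)` is the `M₂`-reading alone (the shape consumed by part F's row lemmas).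
HONEST FRAMING: unconditional, standard axioms; the Néron/`c`-side at `288` is NOT touched; nothing here proves C2/C3, Manin's conjecture or BSD.
[cite: CremonaAlgorithms1997, §2.8, §2.10, Table 1 (288a, 288b, 288c, 288d, 288e)] [cite: AtkinLehner1970, Thm. 3] [cite: DiamondShurman2005, Thm. 3.5.1]
[cite: Koehler2011, §2.1, §2.4] [cite: Ligozat1975, Ch. 3]
-/

set_option autoImplicit false
-- lint-debt: the directory name repeats the summit name (sibling precedent `ManinLocalTwoThreePinningSixtyThree.lean`)
set_option linter.dupNamespace false

noncomputable section


open Complex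
open UpperHalfPlane hiding I
open scoped MatrixGroups ModularForm
open ModularForm CongruenceSubgroup
open Literature.NumberTheory.ModularForms
open Literature.NumberTheory.EllipticCurves Literature.NumberTheory.EllipticCurves.ModularForms

namespace Summit.BirchSwinnertonDyer.BirchSwinnertonDyer.Theorems.ManinLocalTwoThree.PinningTwoEightyEight

open Summit.BirchSwinnertonDyer.BirchSwinnertonDyer.Theorems.ManinLocalTwoThree.BracketSturm
open Summit.BirchSwinnertonDyer.BirchSwinnertonDyer.Theorems.ManinLocalTwoThree.PinningKernel


set_option maxHeartbeats 4000000
set_option maxRecDepth 16384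

/-! ## §3 Duals, tagged relations, the two staged sieve runs -/

/-- **The dual certificate** `⟨dualsᵢ, tabsⱼ⟩ = 288·δᵢⱼ`. [folklore] -/
theorem hdual : ∀ i j : Fin 33, dotList (duals i) (tabs j) = if i = j then (288 : ℤ) else 0 := by
  decide +kernel

/-- **The tagged relation certificate, `ε = 1`**: column relations of the tables, or expanded Fricke combinations. [folklore] -/
theorem hP : ∀ s ∈ stP, ∀ r ∈ s.2, relOK tabs duals sig knum kden 128 1 r = true := by
  decide +kernel

/-- **The tagged relation certificate, `ε = −1`.** [folklore] -/
theorem hM : ∀ s ∈ stM, ∀ r ∈ s.2, relOK tabs duals sig knum kden 128 (-1) r = true := by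
  decide +kernel

/-- The stage primes of the two runs. [folklore] -/
theorem hpsP : stP.map Prod.fst = ps := by decide
/-- The stage primes of the two runs. [folklore] -/
theorem hpsM : stM.map Prod.fst = ps := by decide

/-- Run `P`, stage `0` (`p = 2`): the live list `L_0` is mapped into `L_1` (kernel `decide`). [folklore] -/
theorem hstP0 : ∀ σ ∈ sieveStep 288 128 ((([[]] : List (List (ℕ × ℤ))) :: lvsP).getD 0 []) ((untag stP).getD 0 (0, [])), σ ∈ lvsP.getD 0 [] := by decide +kernel
/-- Run `P`, stage `1` (`p = 3`): the live list `L_1` is mapped into `L_2` (kernel `decide`). [folklore] -/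
theorem hstP1 : ∀ σ ∈ sieveStep 288 128 ((([[]] : List (List (ℕ × ℤ))) :: lvsP).getD 1 []) ((untag stP).getD 1 (0, [])), σ ∈ lvsP.getD 1 [] := by decide +kernel
/-- Run `P`, stage `2` (`p = 5`): the live list `L_2` is mapped into `L_3` (kernel `decide`). [folklore] -/
theorem hstP2 : ∀ σ ∈ sieveStep 288 128 ((([[]] : List (List (ℕ × ℤ))) :: lvsP).getD 2 []) ((untag stP).getD 2 (0, [])), σ ∈ lvsP.getD 2 [] := by decide +kernel
/-- Run `P`, stage `3` (`p = 7`): the live list `L_3` is mapped into `L_4` (kernel `decide`). [folklore] -/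
theorem hstP3 : ∀ σ ∈ sieveStep 288 128 ((([[]] : List (List (ℕ × ℤ))) :: lvsP).getD 3 []) ((untag stP).getD 3 (0, [])), σ ∈ lvsP.getD 3 [] := by decide +kernel
/-- Run `P`, stage `4` (`p = 11`): the live list `L_4` is mapped into `L_5` (kernel `decide`). [folklore] -/
theorem hstP4 : ∀ σ ∈ sieveStep 288 128 ((([[]] : List (List (ℕ × ℤ))) :: lvsP).getD 4 []) ((untag stP).getD 4 (0, [])), σ ∈ lvsP.getD 4 [] := by decide +kernel
/-- Run `P`, stage `5` (`p = 13`): the live list `L_5` is mapped into `L_6` (kernel `decide`). [folklore] -/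
theorem hstP5 : ∀ σ ∈ sieveStep 288 128 ((([[]] : List (List (ℕ × ℤ))) :: lvsP).getD 5 []) ((untag stP).getD 5 (0, [])), σ ∈ lvsP.getD 5 [] := by decide +kernel

/-- **THE SIEVE RUN `P`** (`ε = 1`), certified one stage at a time (`hstP0 … hstP5`), assembled by
`PinningKernel.runSieve_subset_of_chain` (part D): it returns only assignments listed in `certP`. [cite: CremonaAlgorithms1997, §2.10] -/
theorem hcoverP : ∀ σ ∈ runSieve 288 128 (untag stP), σ ∈ certP.map Prod.fst := by
  have hch : ∀ k < (untag stP).length, ∀ σ ∈ sieveStep 288 128 ((([[]] : List (List (ℕ × ℤ))) :: lvsP).getD k [])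
      ((untag stP).getD k (0, [])), σ ∈ lvsP.getD k [] := by
    intro k hk
    have hk' : k < 6 := lt_of_lt_of_eq hk (by decide)
    interval_cases k
    exacts [hstP0, hstP1, hstP2, hstP3, hstP4, hstP5]
  have hlast : ((([[]] : List (List (ℕ × ℤ))) :: lvsP).getD (untag stP).length []) = certP.map Prod.fst := by decide +kernel
  exact fun σ hσ ↦ hlast ▸ runSieve_subset_of_chain 288 128 (untag stP) lvsP (by decide) hch σ hσ

/-- Run `M`, stage `0` (`p = 2`): the live list `L_0` is mapped into `L_1` (kernel `decide`). [folklore] -/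
theorem hstM0 : ∀ σ ∈ sieveStep 288 128 ((([[]] : List (List (ℕ × ℤ))) :: lvsM).getD 0 []) ((untag stM).getD 0 (0, [])), σ ∈ lvsM.getD 0 [] := by decide +kernel
/-- Run `M`, stage `1` (`p = 3`): the live list `L_1` is mapped into `L_2` (kernel `decide`). [folklore] -/
theorem hstM1 : ∀ σ ∈ sieveStep 288 128 ((([[]] : List (List (ℕ × ℤ))) :: lvsM).getD 1 []) ((untag stM).getD 1 (0, [])), σ ∈ lvsM.getD 1 [] := by decide +kernel
/-- Run `M`, stage `2` (`p = 5`): the live list `L_2` is mapped into `L_3` (kernel `decide`). [folklore] -/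
theorem hstM2 : ∀ σ ∈ sieveStep 288 128 ((([[]] : List (List (ℕ × ℤ))) :: lvsM).getD 2 []) ((untag stM).getD 2 (0, [])), σ ∈ lvsM.getD 2 [] := by decide +kernel
/-- Run `M`, stage `3` (`p = 7`): the live list `L_3` is mapped into `L_4` (kernel `decide`). [folklore] -/
theorem hstM3 : ∀ σ ∈ sieveStep 288 128 ((([[]] : List (List (ℕ × ℤ))) :: lvsM).getD 3 []) ((untag stM).getD 3 (0, [])), σ ∈ lvsM.getD 3 [] := by decide +kernel
/-- Run `M`, stage `4` (`p = 11`): the live list `L_4` is mapped into `L_5` (kernel `decide`). [folklore] -/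
theorem hstM4 : ∀ σ ∈ sieveStep 288 128 ((([[]] : List (List (ℕ × ℤ))) :: lvsM).getD 4 []) ((untag stM).getD 4 (0, [])), σ ∈ lvsM.getD 4 [] := by decide +kernel
/-- Run `M`, stage `5` (`p = 13`): the live list `L_5` is mapped into `L_6` (kernel `decide`). [folklore] -/
theorem hstM5 : ∀ σ ∈ sieveStep 288 128 ((([[]] : List (List (ℕ × ℤ))) :: lvsM).getD 5 []) ((untag stM).getD 5 (0, [])), σ ∈ lvsM.getD 5 [] := by decide +kernel

/-- **THE SIEVE RUN `M`** (`ε = −1`), certified one stage at a time (`hstM0 … hstM5`), assembled by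
`PinningKernel.runSieve_subset_of_chain` (part D): it returns only assignments listed in `certM`. [cite: CremonaAlgorithms1997, §2.10] -/
theorem hcoverM : ∀ σ ∈ runSieve 288 128 (untag stM), σ ∈ certM.map Prod.fst := by
  have hch : ∀ k < (untag stM).length, ∀ σ ∈ sieveStep 288 128 ((([[]] : List (List (ℕ × ℤ))) :: lvsM).getD k [])
      ((untag stM).getD k (0, [])), σ ∈ lvsM.getD k [] := by
    intro k hk
    have hk' : k < 6 := lt_of_lt_of_eq hk (by decide)
    interval_cases k
    exacts [hstM0, hstM1, hstM2, hstM3, hstM4, hstM5]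
  have hlast : ((([[]] : List (List (ℕ × ℤ))) :: lvsM).getD (untag stM).length []) = certM.map Prod.fst := by decide +kernel
  exact fun σ hσ ↦ hlast ▸ runSieve_subset_of_chain 288 128 (untag stM) lvsM (by decide) hch σ hσ


/-- **The coordinate certificates** `d'·aₙ(σ) = Σ_j y_j·tabsⱼ[n]` on the dual support, for the candidates of both runs. [folklore] -/
theorem hpiv : ∀ c ∈ certP ++ certM, ∀ i : Fin 33, ∀ n < (duals i).length, (duals i).getD n 0 ≠ 0 →
    (evalOpt 288 c.1 n).map (fun x ↦ c.2.1 * x) = some (∑ j : Fin 33, c.2.2.getD (j : ℕ) 0 * (tabs j).getD n 0) := by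
  decide +kernel

/-! ## §4 The Fricke law of the basis -/

/-- Every exponent row sums to `4` (weight `2`). [folklore] -/
theorem hsum : ∀ i : Fin 33, ∑ δ ∈ (288 : ℕ).divisors, expFn (Ls[(i : ℕ)]).1 δ = 4 := by
  decide +kernel

/-- The basis is `σ`-closed: `r_i(288/δ) = r_{σ i}(δ)` on the divisors. [cite: Koehler2011, §2.4] -/
theorem hsig : ∀ i : Fin 33, ∀ δ ∈ (288 : ℕ).divisors,
    EtaFricke.frickeExp 288 (expFn (Ls[(i : ℕ)]).1) δ = expFn (Ls[((sig i : Fin 33) : ℕ)]).1 δ := by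
  decide +kernel

/-- The Fricke constants: `knum² · ∏_{r>0} δ^r = 288² · kden² · ∏_{r<0} δ^{−r}`. [cite: Koehler2011, §2.4] -/
theorem hK : ∀ i : Fin 33, 0 < knum i ∧ 0 < kden i ∧
    knum i ^ 2 * posPart 288 (expFn (Ls[(i : ℕ)]).1) = 288 ^ 2 * kden i ^ 2 * negPart 288 (expFn (Ls[(i : ℕ)]).1) := by
  decide +kernel

/-! ## §5 `dim S₂(Γ₀(288)) = 33` -/

/-- `μ(Γ₀(288)) = 576`, `ν_∞ = 32`, `ν₂ = ν₃ = 0`. [cite: DiamondShurman2005, §3.8] -/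
theorem gamma0_data : gamma0Index 288 = 576 ∧ nuInfty 288 = 32 ∧ nu₂ 288 = 0 ∧ nu₃ 288 = 0 := by
  refine ⟨?_, by decide, by rw [nu₂_eq_card]; decide, by rw [nu₃_eq_card]; decide⟩
  · rw [(gamma0Index_mul (m := 32) (n := 9) (by norm_num)),
      show (32 : ℕ) = 2 ^ 5 by norm_num, gamma0Index_prime_pow (p := 2) (e := 5) Nat.prime_two (by norm_num),
      show (9 : ℕ) = 3 ^ 2 by norm_num, gamma0Index_prime_pow (p := 3) (e := 2) Nat.prime_three (by norm_num)]
    norm_num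

/-- **`dim S₂(Γ₀(288)) = 33`** (the genus; `μ = 576`, `ν_∞ = 32`), by the tree's `finrank_cuspForm_two_eq_genusX0_holds`.
[cite: DiamondShurman2005, Thm. 3.5.1] -/
theorem finrank_cuspForm_two : Module.finrank ℂ (CuspForm (Gamma0 288) 2) = 33 := by
  obtain ⟨h1, h2, h3, h4⟩ := gamma0_data
  have h : Module.finrank ℂ (CuspForm (Gamma0 288) 2) = genusX0 288 := finrank_cuspForm_two_eq_genusX0_holds 288
  rw [h, genusX0, h1, h2, h3, h4]

/-! ## §6 The pinning (5 certificates = the 5 rational newform classes of level 288; kernel in `S₂(Γ₀(288))`, read in `M₂`) -/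

/-- **LEVEL 288 PINNED IN `S₂(Γ₀(288))` (one of 5 newform classes).**  For every `X₀(288)`-datum `D` of an elliptic `W/ℚ`, with the
cuspidal `η`-quotients `Sᵢ` of `Ls` and their `M₂`-images `Cᵢ`: for some certificate `c = (σ, d', y) ∈ certP ++ certM` (Cremona
`288a`, `288b`, `288c`, `288d`, `288e`), the sieve truth of `W` over `2, 3, 5, 7, 11, 13` is `σ`, `d' • D.f = Σ_j y_j • S_j` in `S₂(Γ₀(288))` and
`d' • f = Σ_j y_j • C_j` in `M₂(Γ₀(288))`. [cite: CremonaAlgorithms1997, §2.10, Table 1 (288a, 288b, 288c, 288d, 288e)] [cite: AtkinLehner1970, Thm. 3] -/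
theorem pinning_cusp {W : WeierstrassCurve ℚ} [W.IsElliptic] (D : ModularParametrizationData W 288) :
    ∃ S : Fin 33 → CuspForm (Gamma0 288) 2, ∃ C : Fin 33 → ModularForm (Gamma0 288) 2,
      (∀ i, ModularFormClass.modularForm (S i) = C i) ∧ (∀ i, ∀ τ : ℍ, C i τ = etaQuotient 288 (expFn (Ls[(i : ℕ)]).1) τ) ∧
      ∃ c ∈ certP ++ certM, truth W ps = c.1 ∧
        ((c.2.1 : ℤ) : ℂ) • D.f = ∑ j : Fin 33, ((c.2.2.getD (j : ℕ) 0 : ℤ) : ℂ) • S j ∧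
        ((c.2.1 : ℤ) : ℂ) • ModularFormClass.modularForm D.f = ∑ j : Fin 33, ((c.2.2.getD (j : ℕ) 0 : ℤ) : ℂ) • C j := by
  have hlen : ∀ i : Fin 33, (duals i).length ≤ 128 := by
    decide +kernel
  have hps : ∀ p ∈ ps, p.Prime := by
    intro p h
    have hl : ps = [2, 3, 5, 7, 11, 13] := rfl
    rw [hl] at h
    simp only [List.mem_cons, List.mem_nil_iff, or_false] at h
    rcases h with h | h | h | h | h | h <;> rw [h] <;> norm_num
  have hinj : Function.Injective sig := by
    decide
  obtain ⟨S, hS⟩ := exists_etaCuspForms 288 Ls hcusp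
  obtain ⟨C, hCS⟩ : ∃ C : Fin 33 → ModularForm (Gamma0 288) 2, ∀ i, ModularFormClass.modularForm (S i) = C i :=
    ⟨_, fun _ ↦ rfl⟩
  have hC : ∀ i, ∀ τ : ℍ, C i τ = etaQuotient 288 (expFn (Ls[(i : ℕ)]).1) τ := fun i τ ↦ by rw [← hCS]; exact hS i τ
  have ht := tables_of_etaCertsSparse 288 128 (fun i : Fin 33 ↦ expFn (Ls[(i : ℕ)]).1) (fun i ↦ shifts i) tabs C hC hshift hcert
  have hW := slash_eq_sum_frickePhi C (fun i : Fin 33 ↦ expFn (Ls[(i : ℕ)]).1) hC sig knum kden hsum hsig hK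
  obtain ⟨c, hc, hc1, hpinS, hpin⟩ := exists_smul_eq_sum_of_frickeStaged 288 D S C hCS tabs duals 288 ht hlen hdual (by norm_num)
    finrank_cuspForm_two sig hinj knum kden (fun i ↦ (hK i).2.1) hW ps hps stP stM hpsP hpsM hP hM certP certM hcoverP hcoverM hpiv
  exact ⟨S, C, hCS, hC, c, hc, hc1.symm, hpinS, hpin⟩

/-- **LEVEL 288 PINNED, `M₂`-READING** (the statement shape consumed by part F's row lemmas and the capstones): for some
`(σ, d′, y) ∈ certP ++ certM`, `truth W ps = σ ∧ d′ • f = Σ_j y_j • C_j` in `M₂(Γ₀(288))`.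
[cite: CremonaAlgorithms1997, §2.10, Table 1 (288a, 288b, 288c, 288d, 288e)] [cite: AtkinLehner1970, Thm. 3] -/
theorem pinning {W : WeierstrassCurve ℚ} [W.IsElliptic] (D : ModularParametrizationData W 288) :
    ∃ C : Fin 33 → ModularForm (Gamma0 288) 2, (∀ i, ∀ τ : ℍ, C i τ = etaQuotient 288 (expFn (Ls[(i : ℕ)]).1) τ) ∧
      ∃ c ∈ certP ++ certM, truth W ps = c.1 ∧
        ((c.2.1 : ℤ) : ℂ) • ModularFormClass.modularForm D.f = ∑ j : Fin 33, ((c.2.2.getD (j : ℕ) 0 : ℤ) : ℂ) • C j := by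
  obtain ⟨S, C, -, hC, c, hc, h1, -, h2⟩ := pinning_cusp D
  exact ⟨C, hC, c, hc, h1, h2⟩

end Summit.BirchSwinnertonDyer.BirchSwinnertonDyer.Theorems.ManinLocalTwoThree.PinningTwoEightyEight

end
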